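import Literature.Computation.Certificates.ConicCertificateLayout
import Literature.Computation.Certificates.SemidefiniteRigorousBoundsEnclosure

/-!
# Kernel-replayable layout of the INTERVAL-DATA extension of `certsdp-problem/1` + `certsdp-conic/1` (entrywise radii, box claim)

Topic `Literature/Computation/Certificates`; sibling of `ConicCertificateLayout` (the released LOWER
kind) in the same EXACT-RATIONAL, `Bool`-checked style.  The extension (certnum
`sdp/FORMAT-problem1-interval-DRAFT.md` v0.95, §2–§4) lets the problem document state ENTRYWISE RADII
`r` of its data — the document itself is the MIDPOINT instance `d`; with radii it denotes the FAMILY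
of instances `d′`, `|d′ − d| ≤ r` entrywise (objective row and constant, equality rows and right-hand
sides, inequality rows and upper sides, constant and coefficient matrices of the PSD blocks), all with
the SAME unit variable, a-priori bounds `ρ_v` and trace bounds `τ_k` — and lets ONE lower certificate
computed on the midpoint carry a BOX CLAIM: with its exact residuals `r_v`, `β` and multipliers
`λ, κ, Z_k` (`ConicLayout.LowerCert`),
`L_v = rad(c_v) + Σ_e |λ_e| rad(row_e[v]) + Σ_i κ_i rad(row_i[v]) + Σ_k Σ_{a,b} |Z_k[a,b]| rad(F_{k,v}[b,a])`
(every `v`, the unit variable `u` included),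
`L_β = rad(c₀) + L_u + Σ_e |λ_e| rad(rhs_e) + Σ_i κ_i rad(upper_i) + Σ_k Σ_{a,b} |Z_k[a,b]| rad(C_k[b,a])`,
`box_penalty = L_β + Σ_{v ≠ u} ρ_v L_v`, `lower_bound_box = lower_bound − box_penalty` (§3; the radius
of a symmetric block entry is stored at both `(a,b)` and `(b,a)` here, so `Σ_{a,b}` carries the readers'
weight `m_ab = 1` on and `2` off the diagonal).  Stated here: `Radii` (the `interval` member);
`RealData.{block, obj, Feasible, TraceBounds, InBox}` (a REAL instance of the box — the true data, e.g.
integrals, not only rational documents), `Problem.realData` (a rational document as an instance);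
`LowerCert.{boxL, boxLbeta, boxPenalty}` (the recomputation §4 (ii)); `LowerCertBox` (+ the pinned
sub-claims) and `LowerCertBox.check : Bool` = `LowerCert.check` ∧ §4 (v) «`ρ_v = none ⇒ L_v = 0`» ∧
§4 (iii) both sub-claims EQUAL their recomputation; `LowerCertBox.sound` (`check = true ⇒
lower_bound_box ≤ c′·y + c₀′` for EVERY instance `d′` of the box and EVERY `y` feasible for `d′` with
the trace bounds), `sound'` (all floors `d_k ≥ 0`: no trace bounds), `le_csInf(')`, `sound_problem`.
SOURCE: [Jansson2007] remark after (4.3), p. 9 — «If interval arithmetic is used, then the input data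
A,b,c may be intervals, and we obtain a lower bound for each instance within the interval data» (held
text `paper:arxiv-0707.4366` p0009, re-read 2026-08-27); [JanssonChaykinKeil2008] Thm 3.2 (interval
input data).  MECHANISM: a COROLLARY of `JanssonChaykinKeil.lmiForm_bound_of_abs_le` (this directory;
the decl of record of the format) with `R_v := |r_v| + L_v`, `β_lo := β − L_β` from the triangle
inequality — the residuals are affine in the data with the multipliers as coefficients, so
`|r_v(d′) − r_v(d)| ≤ L_v`, `|β(d′) − β(d)| ≤ L_β`.  DEVIATIONS from print: inequality (LMI) form with
explicit a-priori bounds, as everywhere in `ConicLayout`; the interval family is the entrywise box of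
the format, real instances; the sub-claims are checked as EQUALITIES because the readers pin them
(soundness uses `≤`).  CERTIFICATE KIND: `certsdp-conic/1` with `requires ∋ interval_box` against a
`certsdp-problem/1` with `requires ∋ interval_data`; FIELDS: `Radii ↦ interval{objective{row, const},
eq_rows{row, rhs}, ineq_rows{row, upper}, psd_blocks{entries, const}}`,
`LowerCertBox.boxPenaltyClaimed ↦ claimed.box_penalty`, `lowerBoundBox ↦ claimed.lower_bound_box`, the
rest as in `LowerCert`.  NOT COVERED: the JSON grammar of §2 (canonical literals, `a ≤ b`, closed keys),
the `requires` mechanism §4 (0) and the verdict words (MALFORMED / NO-READ / NO-ACCEPT) — parse-level,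
no arithmetic content; instance-dependent a-priori bounds; the upper side (`certsdp-primal/1` carries
no box claim in v1, §6).  No named facts, no instances, no `sorry`; everything stated is proved.
-/

namespace Literature.Computation.Certificates

open Matrix Finset
open scoped BigOperators

namespace ConicLayout

/-! ### §0 Plumbing (generic finite types) -/

/-- `tr (Z F) = ⟨Z, F⟩` after casting to `ℝ`. [folklore] -/
private theorem trace_map_mul_map' {m : Type*} [Fintype m] (Z F : Matrix m m ℚ) :
    trace (Z.map (Rat.cast : ℚ → ℝ) * F.map (Rat.cast : ℚ → ℝ)) = (pairing Z F : ℝ) := by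
  simp [Matrix.trace, Matrix.mul_apply, pairing, Rat.cast_sum, Rat.cast_mul]

/-- `|Σ_j a_j d_j| ≤ Σ_j |a_j| r_j` when `|d_j| ≤ r_j`. [folklore] -/
private theorem abs_sum_mul_le {n : Type*} [Fintype n] {a d r : n → ℝ} (h : ∀ j, |d j| ≤ r j) :
    |∑ j, a j * d j| ≤ ∑ j, |a j| * r j :=
  (Finset.abs_sum_le_sum_abs _ _).trans (Finset.sum_le_sum fun j _ => by
    rw [abs_mul]; exact mul_le_mul_of_nonneg_left (h j) (abs_nonneg _))

/-- `Σ_a Σ_b |Z_ab| R_ba` — the readers' `Σ_{(a,b) stored} m_ab |Z[a,b]| rad[a,b]` (`m_ab = 1` on the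
diagonal, `2` off it) when the radius of a symmetric entry is stored at both `(a,b)` and `(b,a)`.
[folklore] -/
def absPairing {m : Type*} [Fintype m] (Z R : Matrix m m ℚ) : ℚ :=
  ∑ a, ∑ b, |Z a b| * R b a

/-- `|tr(Z F′) − tr(Z F)| ≤ Σ_a Σ_b |Z_ab| R_ba` when `|F′ − F| ≤ R` entrywise. [folklore] -/
private theorem abs_trace_mul_sub_le {m : Type*} [Fintype m] (Z : Matrix m m ℚ)
    {F' F : Matrix m m ℝ} {R : Matrix m m ℚ} (h : ∀ a b, |F' a b - F a b| ≤ (R a b : ℝ)) :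
    |trace (Z.map (Rat.cast : ℚ → ℝ) * F') - trace (Z.map (Rat.cast : ℚ → ℝ) * F)| ≤
      (absPairing Z R : ℝ) := by
  have hdiff : trace (Z.map (Rat.cast : ℚ → ℝ) * F') - trace (Z.map (Rat.cast : ℚ → ℝ) * F) =
      ∑ a, ∑ b, (Z a b : ℝ) * (F' b a - F b a) := by
    simp only [Matrix.trace, Matrix.diag_apply, Matrix.mul_apply, Matrix.map_apply, mul_sub,
      Finset.sum_sub_distrib]
  rw [hdiff, absPairing, Rat.cast_sum]
  refine (Finset.abs_sum_le_sum_abs _ _).trans (Finset.sum_le_sum fun a _ => ?_)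
  rw [Rat.cast_sum]
  refine (abs_sum_mul_le (a := fun b => (Z a b : ℝ)) fun b => h b a).trans (le_of_eq ?_)
  simp [Rat.cast_mul, Rat.cast_abs]

variable {V E I K : Type*} [Fintype V] [DecidableEq V] [Fintype E] [Fintype I] [Fintype K]
variable {σ : K → Type*} [∀ k, Fintype (σ k)] [∀ k, DecidableEq (σ k)]
variable {π : K → Type*} [∀ k, Fintype (π k)]

/-! ### §1 The `interval` member and the instances of the entrywise box -/

/-- The `interval` member of `certsdp-problem/1` (format `entrywise-radius/0`): ENTRYWISE RADII of
the stated program — on the objective row `c_v` and constant `c₀`, the equality rows `row_e[v]` and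
right-hand sides `rhs_e`, the inequality rows `row_i[v]` and upper sides `upper_i`, the constant
`C_k[a,b]` and coefficient `F_{k,v}[a,b]` block entries (stored SYMMETRICALLY, like the block data of
`Problem`); absent = `0`.  The interval input data of [cite: Jansson2007, remark after (4.3), p. 9] /
[cite: JanssonChaykinKeil2008, Thm 3.2 (interval input data)] in the reader's field layout. -/
structure Radii (V E I K : Type*) (σ : K → Type*) where
  /-- radii of the objective row -/ c : V → ℚ
  /-- radius of the objective constant -/ c0 : ℚ
  /-- radii of the equality rows -/ rowE : E → V → ℚ
  /-- radii of the right-hand sides -/ rhs : E → ℚ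
  /-- radii of the inequality rows -/ rowI : I → V → ℚ
  /-- radii of the upper sides -/ upper : I → ℚ
  /-- radii of the constant block entries `C_k[a,b]` (symmetric) -/ Cb : ∀ k, Matrix (σ k) (σ k) ℚ
  /-- radii of the coefficient block entries `F_{k,v}[a,b]` (symmetric) -/
  F : ∀ k, V → Matrix (σ k) (σ k) ℚ

/-- A REAL INSTANCE `d′` of the program data (the true objective, rows and block data — real numbers,
e.g. integrals, of which the document's rationals are roundings); the unit variable, the a-priori
bounds and the trace bounds are the document's. [cite: Jansson2007, remark after (4.3), p. 9] -/
structure RealData (V E I K : Type*) (σ : K → Type*) where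
  /-- objective row -/ c : V → ℝ
  /-- objective constant -/ c0 : ℝ
  /-- equality rows -/ rowE : E → V → ℝ
  /-- right-hand sides -/ rhs : E → ℝ
  /-- inequality rows -/ rowI : I → V → ℝ
  /-- upper sides -/ upper : I → ℝ
  /-- constant parts of the PSD blocks -/ Cb : ∀ k, Matrix (σ k) (σ k) ℝ
  /-- coefficient matrices of the PSD blocks -/ F : ∀ k, V → Matrix (σ k) (σ k) ℝ

namespace RealData

/-- The block `M′_k(y) = C′_k + Σ_v y_v F′_{k,v}` of an instance. [folklore] -/
noncomputable def block (D : RealData V E I K σ) (k : K) (y : V → ℝ) : Matrix (σ k) (σ k) ℝ :=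
  D.Cb k + ∑ v, y v • D.F k v

/-- The objective `c′·y + c₀′` of an instance. [folklore] -/
noncomputable def obj (D : RealData V E I K σ) (y : V → ℝ) : ℝ :=
  ∑ v, D.c v * y v + D.c0

/-- **Feasibility of `y` for the instance `d′`**: the document's unit variable and a-priori bounds,
the INSTANCE's rows and PSD blocks. [cite: JanssonChaykinKeil2008, Thm 3.2 (interval input data:
feasibility for a realisation)] -/
structure Feasible (P : Problem V E I K σ) (D : RealData V E I K σ) (y : V → ℝ) : Prop where
  /-- the unit variable -/ unit : y P.unit = 1
  /-- the a-priori bounds of the document -/ box : ∀ v, ∀ q ∈ P.rho v, |y v| ≤ (q : ℝ)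
  /-- the instance's equality rows -/ eq : ∀ e, ∑ v, D.rowE e v * y v = D.rhs e
  /-- the instance's inequality rows -/ le : ∀ i, ∑ v, D.rowI i v * y v ≤ D.upper i
  /-- the instance's PSD blocks -/ psd : ∀ k, (D.block k y).PosSemidef

/-- The document's a-priori TRACE BOUNDS for the instance's blocks at `y` (uniform over the box,
FORMAT §2). [cite: JanssonChaykinKeil2008, Thm 3.2 (a-priori bound, uniform over the interval data)] -/
def TraceBounds (P : Problem V E I K σ) (D : RealData V E I K σ) (y : V → ℝ) : Prop :=
  ∀ k, ∀ q ∈ P.tau k, (D.block k y).trace ≤ (q : ℝ)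

/-- **Membership of the instance in the entrywise box** `|d′ − d| ≤ r` of a problem document `d` with
radii `r`. [cite: Jansson2007, remark after (4.3), p. 9] -/
structure InBox (P : Problem V E I K σ) (R : Radii V E I K σ) (D : RealData V E I K σ) : Prop where
  /-- objective row -/ c : ∀ v, |D.c v - (P.c v : ℝ)| ≤ (R.c v : ℝ)
  /-- objective constant -/ c0 : |D.c0 - (P.c0 : ℝ)| ≤ (R.c0 : ℝ)
  /-- equality rows -/ rowE : ∀ e v, |D.rowE e v - (P.rowE e v : ℝ)| ≤ (R.rowE e v : ℝ)
  /-- right-hand sides -/ rhs : ∀ e, |D.rhs e - (P.rhs e : ℝ)| ≤ (R.rhs e : ℝ)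
  /-- inequality rows -/ rowI : ∀ i v, |D.rowI i v - (P.rowI i v : ℝ)| ≤ (R.rowI i v : ℝ)
  /-- upper sides -/ upper : ∀ i, |D.upper i - (P.upper i : ℝ)| ≤ (R.upper i : ℝ)
  /-- constant block entries -/ Cb : ∀ k a b, |D.Cb k a b - (P.Cb k a b : ℝ)| ≤ (R.Cb k a b : ℝ)
  /-- coefficient block entries -/
  F : ∀ k v a b, |D.F k v a b - (P.F k v a b : ℝ)| ≤ (R.F k v a b : ℝ)

end RealData

namespace Problem

/-- A problem document's own data as an instance (the MIDPOINT of its box); also the embedding through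
which a second RATIONAL document is an instance of a box (`LowerCertBox.sound_problem`). [folklore] -/
noncomputable def realData (P : Problem V E I K σ) : RealData V E I K σ where
  c v := P.c v
  c0 := P.c0
  rowE e v := P.rowE e v
  rhs e := P.rhs e
  rowI i v := P.rowI i v
  upper i := P.upper i
  Cb k := (P.Cb k).map (Rat.cast : ℚ → ℝ)
  F k v := (P.F k v).map (Rat.cast : ℚ → ℝ)

omit [DecidableEq V] [Fintype E] [Fintype I] [Fintype K] [∀ k, Fintype (σ k)]
  [∀ k, DecidableEq (σ k)] in
/-- The instance semantics of a document's own data is the document's semantics, for documents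
sharing the unit variable and the a-priori bounds (`realData.block = block` holds by `rfl`).
[cite: JanssonChaykinKeil2008, Thm 3.2 (a realisation of the interval data)] -/
theorem feasible_realData_iff {P P' : Problem V E I K σ} (hu : P'.unit = P.unit)
    (hρ : P'.rho = P.rho) {y : V → ℝ} : P'.realData.Feasible P y ↔ P'.Feasible y :=
  ⟨fun ⟨h1, h2, h3, h4, h5⟩ => ⟨by rw [hu]; exact h1, by rw [hρ]; exact h2, h3, h4, h5⟩,
    fun ⟨h1, h2, h3, h4, h5⟩ => ⟨by rw [← hu]; exact h1, by rw [← hρ]; exact h2, h3, h4, h5⟩⟩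

end Problem

/-! ### §2 The box claim of a lower certificate and its acceptance -/

namespace LowerCert

/-- `L_v = rad(c_v) + Σ_e |λ_e| rad(row_e[v]) + Σ_i κ_i rad(row_i[v]) + Σ_k Σ_{a,b} |Z_k[a,b]| rad(F_{k,v}[b,a])`
— the variation of the residual `r_v` over the box (FORMAT §3; every `v`, the unit variable included).
[folklore] -/
def boxL (R : Radii V E I K σ) (C : LowerCert V E I K σ π) (v : V) : ℚ :=
  R.c v + ∑ e, |C.lam e| * R.rowE e v + ∑ i, C.kap i * R.rowI i v +
    ∑ k, absPairing (C.wit k).Z (R.F k v)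

/-- `L_β = rad(c₀) + L_u + Σ_e |λ_e| rad(rhs_e) + Σ_i κ_i rad(upper_i) + Σ_k Σ_{a,b} |Z_k[a,b]| rad(C_k[b,a])`
— the variation of `β` over the box (FORMAT §3). [folklore] -/
def boxLbeta (P : Problem V E I K σ) (R : Radii V E I K σ) (C : LowerCert V E I K σ π) : ℚ :=
  R.c0 + boxL R C P.unit + ∑ e, |C.lam e| * R.rhs e + ∑ i, C.kap i * R.upper i +
    ∑ k, absPairing (C.wit k).Z (R.Cb k)

/-- `box_penalty = L_β + Σ_{v ≠ u} ρ_v L_v` RECOMPUTED (FORMAT §4 (ii)/(iii); a free variable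
`ρ_v = none` contributes `0` and must carry `L_v = 0`, §4 (v)). [folklore] -/
def boxPenalty (P : Problem V E I K σ) (R : Radii V E I K σ) (C : LowerCert V E I K σ π) : ℚ :=
  boxLbeta P R C + ∑ v ∈ univ.erase P.unit, (P.rho v).getD 0 * boxL R C v

end LowerCert

/-- A lower certificate WITH A BOX CLAIM (`certsdp-conic/1` listing `interval_box`): the ordinary
certificate plus the two pinned exact sub-claims `claimed.box_penalty`, `claimed.lower_bound_box`
(FORMAT §3). [cite: Jansson2007, remark after (4.3), p. 9] -/
structure LowerCertBox (V E I K : Type*) (σ π : K → Type*) extends LowerCert V E I K σ π where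
  /-- `claimed.box_penalty` -/ boxPenaltyClaimed : ℚ
  /-- `claimed.lower_bound_box` -/ lowerBoundBox : ℚ

namespace LowerCertBox

/-- **Acceptance of a box-claiming lower certificate** (FORMAT §4): the ordinary acceptance
`LowerCert.check` (K-1…K-5 on the midpoint); (v) no radius touches a free variable's column
(`ρ_v = none ⇒ L_v = 0`); (iii) `claimed.box_penalty = L_β + Σ_{v≠u} ρ_v L_v` and
`claimed.lower_bound_box = claimed.lower_bound − claimed.box_penalty`, EXACT equalities — a `Bool` of
the exact data (kernel-evaluable by `decide`). [folklore] -/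
def check (P : Problem V E I K σ) (R : Radii V E I K σ) (C : LowerCertBox V E I K σ π) : Bool :=
  LowerCert.check P C.toLowerCert &&
    decide (∀ v, v ≠ P.unit → P.rho v = none → LowerCert.boxL R C.toLowerCert v = 0) &&
    decide (C.boxPenaltyClaimed = LowerCert.boxPenalty P R C.toLowerCert) &&
    decide (C.lowerBoundBox = C.lowerBound - C.boxPenaltyClaimed)

omit [Fintype V] [DecidableEq V] in
/-- The residual of an instance differs from the midpoint residual by at most `L_v` (`κ ≥ 0`).
[folklore] -/
private theorem abs_residual_sub_le {P : Problem V E I K σ} {R : Radii V E I K σ}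
    {C : LowerCert V E I K σ π} (hκ : ∀ i, 0 ≤ C.kap i) {D : RealData V E I K σ} (hD : D.InBox P R)
    (v : V) :
    |(D.c v - ∑ e, (C.lam e : ℝ) * D.rowE e v + ∑ i, (C.kap i : ℝ) * D.rowI i v -
        ∑ k, trace ((C.wit k).Z.map (Rat.cast : ℚ → ℝ) * D.F k v)) -
        (LowerCert.residual P C v : ℝ)| ≤ (LowerCert.boxL R C v : ℝ) := by
  have hc := hD.c v
  have hE : |∑ e, (C.lam e : ℝ) * D.rowE e v - ∑ e, (C.lam e : ℝ) * (P.rowE e v : ℝ)| ≤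
      ∑ e, |(C.lam e : ℝ)| * (R.rowE e v : ℝ) := by
    rw [← Finset.sum_sub_distrib]; simp_rw [← mul_sub]; exact abs_sum_mul_le fun e => hD.rowE e v
  have hI : |∑ i, (C.kap i : ℝ) * D.rowI i v - ∑ i, (C.kap i : ℝ) * (P.rowI i v : ℝ)| ≤
      ∑ i, (C.kap i : ℝ) * (R.rowI i v : ℝ) := by
    rw [← Finset.sum_sub_distrib]; simp_rw [← mul_sub]
    refine (abs_sum_mul_le fun i => hD.rowI i v).trans (le_of_eq (Finset.sum_congr rfl fun i _ => ?_))
    rw [abs_of_nonneg (show (0 : ℝ) ≤ (C.kap i : ℝ) by exact_mod_cast hκ i)]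
  have hK : |∑ k, trace ((C.wit k).Z.map (Rat.cast : ℚ → ℝ) * D.F k v) -
      ∑ k, trace ((C.wit k).Z.map (Rat.cast : ℚ → ℝ) * (P.F k v).map (Rat.cast : ℚ → ℝ))| ≤
      ∑ k, (absPairing (C.wit k).Z (R.F k v) : ℝ) := by
    rw [← Finset.sum_sub_distrib]
    exact (Finset.abs_sum_le_sum_abs _ _).trans (Finset.sum_le_sum fun k _ =>
      abs_trace_mul_sub_le _ fun a b => by simpa only [Matrix.map_apply] using hD.F k v a b)
  have hres : (LowerCert.residual P C v : ℝ) = (P.c v : ℝ) - ∑ e, (C.lam e : ℝ) * (P.rowE e v : ℝ) +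
      ∑ i, (C.kap i : ℝ) * (P.rowI i v : ℝ) -
      ∑ k, trace ((C.wit k).Z.map (Rat.cast : ℚ → ℝ) * (P.F k v).map (Rat.cast : ℚ → ℝ)) := by
    simp only [LowerCert.residual, Rat.cast_sub, Rat.cast_add, Rat.cast_sum, Rat.cast_mul,
      trace_map_mul_map']
  have hL : (LowerCert.boxL R C v : ℝ) = (R.c v : ℝ) + ∑ e, |(C.lam e : ℝ)| * (R.rowE e v : ℝ) +
      ∑ i, (C.kap i : ℝ) * (R.rowI i v : ℝ) + ∑ k, (absPairing (C.wit k).Z (R.F k v) : ℝ) := by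
    simp only [LowerCert.boxL, Rat.cast_add, Rat.cast_sum, Rat.cast_mul, Rat.cast_abs]
  rw [hres, hL, abs_le]
  rw [abs_le] at hc hE hI hK
  constructor <;> linarith [hc.1, hc.2, hE.1, hE.2, hI.1, hI.2, hK.1, hK.2]

omit [Fintype V] [DecidableEq V] in
/-- `β` of an instance differs from the midpoint `β` by at most `L_β` (`κ ≥ 0`). [folklore] -/
private theorem abs_beta_sub_le {P : Problem V E I K σ} {R : Radii V E I K σ}
    {C : LowerCert V E I K σ π} (hκ : ∀ i, 0 ≤ C.kap i) {D : RealData V E I K σ} (hD : D.InBox P R) :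
    |(D.c0 + (D.c P.unit - ∑ e, (C.lam e : ℝ) * D.rowE e P.unit + ∑ i, (C.kap i : ℝ) * D.rowI i P.unit -
        ∑ k, trace ((C.wit k).Z.map (Rat.cast : ℚ → ℝ) * D.F k P.unit)) +
        ∑ e, (C.lam e : ℝ) * D.rhs e - ∑ i, (C.kap i : ℝ) * D.upper i -
        ∑ k, trace ((C.wit k).Z.map (Rat.cast : ℚ → ℝ) * D.Cb k)) - (LowerCert.beta P C : ℝ)| ≤
      (LowerCert.boxLbeta P R C : ℝ) := by
  have hc0 := hD.c0
  have hu := abs_residual_sub_le hκ hD P.unit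
  have hE : |∑ e, (C.lam e : ℝ) * D.rhs e - ∑ e, (C.lam e : ℝ) * (P.rhs e : ℝ)| ≤
      ∑ e, |(C.lam e : ℝ)| * (R.rhs e : ℝ) := by
    rw [← Finset.sum_sub_distrib]; simp_rw [← mul_sub]; exact abs_sum_mul_le fun e => hD.rhs e
  have hI : |∑ i, (C.kap i : ℝ) * D.upper i - ∑ i, (C.kap i : ℝ) * (P.upper i : ℝ)| ≤
      ∑ i, (C.kap i : ℝ) * (R.upper i : ℝ) := by
    rw [← Finset.sum_sub_distrib]; simp_rw [← mul_sub]
    refine (abs_sum_mul_le fun i => hD.upper i).trans (le_of_eq (Finset.sum_congr rfl fun i _ => ?_))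
    rw [abs_of_nonneg (show (0 : ℝ) ≤ (C.kap i : ℝ) by exact_mod_cast hκ i)]
  have hK : |∑ k, trace ((C.wit k).Z.map (Rat.cast : ℚ → ℝ) * D.Cb k) -
      ∑ k, trace ((C.wit k).Z.map (Rat.cast : ℚ → ℝ) * (P.Cb k).map (Rat.cast : ℚ → ℝ))| ≤
      ∑ k, (absPairing (C.wit k).Z (R.Cb k) : ℝ) := by
    rw [← Finset.sum_sub_distrib]
    exact (Finset.abs_sum_le_sum_abs _ _).trans (Finset.sum_le_sum fun k _ =>
      abs_trace_mul_sub_le _ fun a b => by simpa only [Matrix.map_apply] using hD.Cb k a b)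
  have hbeta : (LowerCert.beta P C : ℝ) = (P.c0 : ℝ) + (LowerCert.residual P C P.unit : ℝ) +
      ∑ e, (C.lam e : ℝ) * (P.rhs e : ℝ) - ∑ i, (C.kap i : ℝ) * (P.upper i : ℝ) -
      ∑ k, trace ((C.wit k).Z.map (Rat.cast : ℚ → ℝ) * (P.Cb k).map (Rat.cast : ℚ → ℝ)) := by
    simp only [LowerCert.beta, Rat.cast_sub, Rat.cast_add, Rat.cast_sum, Rat.cast_mul,
      trace_map_mul_map']
  have hL : (LowerCert.boxLbeta P R C : ℝ) = (R.c0 : ℝ) + (LowerCert.boxL R C P.unit : ℝ) +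
      ∑ e, |(C.lam e : ℝ)| * (R.rhs e : ℝ) + ∑ i, (C.kap i : ℝ) * (R.upper i : ℝ) +
      ∑ k, (absPairing (C.wit k).Z (R.Cb k) : ℝ) := by
    simp only [LowerCert.boxLbeta, Rat.cast_add, Rat.cast_sum, Rat.cast_mul, Rat.cast_abs]
  rw [hbeta, hL, abs_le]
  rw [abs_le] at hc0 hu hE hI hK
  constructor <;> linarith [hc0.1, hc0.2, hu.1, hu.2, hE.1, hE.2, hI.1, hI.2, hK.1, hK.2]

/-- The core estimate: an accepted box certificate bounds the objective of every instance of the box at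
every point feasible for that instance, given real trace majorants whose penalty is covered by the
certificate's. [cite: Jansson2007, Thm 4.2 and remark after (4.3), p. 9]
[cite: JanssonChaykinKeil2008, Lemma 3.1 and Thm 3.2 (interval input data)] -/
private theorem bound_core {P : Problem V E I K σ} {R : Radii V E I K σ} {C : LowerCertBox V E I K σ π}
    (h : check P R C = true) {D : RealData V E I K σ} (hD : D.InBox P R) {y : V → ℝ}
    (hy : D.Feasible P y) (τ : K → ℝ) (hτ : ∀ k, (D.block k y).trace ≤ τ k)
    (hpen : ∑ k, |min 0 ((C.wit k).dfloor : ℝ)| * τ k ≤ (LowerCert.penalty P C.toLowerCert : ℝ)) :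
    (C.lowerBoundBox : ℝ) ≤ D.obj y := by
  simp only [check, LowerCert.check, Bool.and_eq_true, decide_eq_true_eq] at h
  obtain ⟨⟨⟨⟨⟨⟨⟨hκ, hnone⟩, hrows⟩, _⟩, hlb⟩, hfree⟩, hbp⟩, hlbb⟩ := h
  -- the box of `y` actually used: `ρ_v`, or `|y_v|` itself for a free variable (`r_v = L_v = 0` there)
  let ρ : V → ℝ := fun v => (P.rho v).elim |y v| fun q => (q : ℝ)
  have hρ : ∀ v, v ≠ P.unit → |y v| ≤ ρ v := fun v _ => by
    cases hq : P.rho v with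
    | none => simp [ρ, hq]
    | some q => simpa [ρ, hq] using hy.box v q (by simp [hq])
  -- `lmiForm_bound_of_abs_le` for the instance, with `R_v := |r_v| + L_v` and `β_lo := β − L_β`
  have hmain := JanssonChaykinKeil.lmiForm_bound_of_abs_le D.c D.c0 P.unit D.rowE D.rhs D.rowI
    D.upper D.Cb D.F ρ τ hy.unit hρ hy.eq hy.le hy.psd hτ
    (fun e => (C.lam e : ℝ)) (fun i => (C.kap i : ℝ)) (fun i => by exact_mod_cast hκ i)
    (fun k => (C.wit k).Z.map (Rat.cast : ℚ → ℝ)) (fun k => ((C.wit k).dfloor : ℝ))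
    (fun k => (C.wit k).posSemidef_sub_dfloor (hrows k))
    (fun v => ((|LowerCert.residual P C.toLowerCert v| + LowerCert.boxL R C.toLowerCert v : ℚ) : ℝ))
    (fun v _ => by
      have h1 := abs_residual_sub_le (P := P) hκ hD v
      have h2 := abs_sub_abs_le_abs_sub
        (D.c v - ∑ e, (C.lam e : ℝ) * D.rowE e v + ∑ i, (C.kap i : ℝ) * D.rowI i v -
          ∑ k, trace ((C.wit k).Z.map (Rat.cast : ℚ → ℝ) * D.F k v))
        (LowerCert.residual P C.toLowerCert v : ℝ)
      push_cast
      linarith)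
    ((LowerCert.beta P C.toLowerCert : ℝ) - (LowerCert.boxLbeta P R C.toLowerCert : ℝ))
    (by have h1 := abs_beta_sub_le (P := P) hκ hD; rw [abs_le] at h1; linarith [h1.1])
  -- `Σ_{v≠u} R_v ρ_v = ℓ₁ + Σ_{v≠u} ρ_v L_v` (free variables: both sides `0`)
  have hsumR : ∑ v ∈ univ.erase P.unit,
      ((|LowerCert.residual P C.toLowerCert v| + LowerCert.boxL R C.toLowerCert v : ℚ) : ℝ) * ρ v =
      (LowerCert.l1 P C.toLowerCert : ℝ) +
        ∑ v ∈ univ.erase P.unit, (((P.rho v).getD 0 * LowerCert.boxL R C.toLowerCert v : ℚ) : ℝ) := by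
    rw [LowerCert.l1, Rat.cast_sum, ← Finset.sum_add_distrib]
    refine Finset.sum_congr rfl fun v hv => ?_
    have hvu : v ≠ P.unit := Finset.ne_of_mem_erase hv
    cases hq : P.rho v with
    | none => simp [hnone v hvu hq, hfree v hvu hq]
    | some q =>
        simp only [ρ, hq, Option.elim_some, Option.getD_some, Rat.cast_add, Rat.cast_mul,
          Rat.cast_abs]
        ring
  have hbp' : (C.boxPenaltyClaimed : ℝ) = (LowerCert.boxLbeta P R C.toLowerCert : ℝ) +
      ∑ v ∈ univ.erase P.unit, (((P.rho v).getD 0 * LowerCert.boxL R C.toLowerCert v : ℚ) : ℝ) := by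
    rw [hbp, LowerCert.boxPenalty, Rat.cast_add, Rat.cast_sum]
  have hlb' : (C.lowerBound : ℝ) ≤ (LowerCert.beta P C.toLowerCert : ℝ) -
      (LowerCert.l1 P C.toLowerCert : ℝ) - (LowerCert.penalty P C.toLowerCert : ℝ) := by
    exact_mod_cast hlb
  have hlbb' : (C.lowerBoundBox : ℝ) = (C.lowerBound : ℝ) - (C.boxPenaltyClaimed : ℝ) := by
    rw [hlbb, Rat.cast_sub]
  rw [hsumR] at hmain
  rw [hlbb', RealData.obj]
  linarith

/-- **Soundness of the box claim**: if a box-claiming lower certificate is accepted, then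
`claimed.lower_bound_box ≤ c′·y + c₀′` for EVERY instance `d′` of the entrywise box and every `y`
feasible FOR THAT INSTANCE at which the document's a-priori trace bounds hold — «a lower bound for each
instance within the interval data». [cite: Jansson2007, Thm 4.2 and remark after (4.3), p. 9]
[cite: JanssonChaykinKeil2008, Lemma 3.1 and Thm 3.2 (interval input data)]
[cite: Rump1999VerifiedLargeSystems, §4, Algorithm 4.1 step 7] -/
theorem sound {P : Problem V E I K σ} {R : Radii V E I K σ} {C : LowerCertBox V E I K σ π}
    (h : check P R C = true) {D : RealData V E I K σ} (hD : D.InBox P R) {y : V → ℝ}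
    (hy : D.Feasible P y) (htr : D.TraceBounds P y) : (C.lowerBoundBox : ℝ) ≤ D.obj y := by
  have hsome : ∀ k, (C.wit k).dfloor < 0 → (P.tau k).isSome = true := by
    have h' := h
    simp only [check, LowerCert.check, Bool.and_eq_true, decide_eq_true_eq] at h'
    exact h'.1.1.1.1.2
  -- trace majorants: the declared bound where present, the trace itself otherwise
  let τ : K → ℝ := fun k => (P.tau k).elim (D.block k y).trace fun q => (q : ℝ)
  refine bound_core h hD hy τ (fun k => ?_) (le_of_eq ?_)
  · cases hq : P.tau k with
    | none => simp [τ, hq]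
    | some q => simpa [τ, hq] using htr k q (by simp [hq])
  · rw [LowerCert.penalty, Rat.cast_sum]
    refine Finset.sum_congr rfl fun k _ => ?_
    cases hq : P.tau k with
    | none =>
        have h0 : 0 ≤ (C.wit k).dfloor := by
          by_contra hlt
          have := hsome k (lt_of_not_ge hlt)
          simp [hq] at this
        have h0' : (0 : ℝ) ≤ ((C.wit k).dfloor : ℝ) := by exact_mod_cast h0
        simp [min_eq_left h0', min_eq_left h0]
    | some q => simp [τ, hq, Rat.cast_mul, Rat.cast_abs, Rat.cast_min]

/-- **Soundness without trace bounds**: if moreover every eigenvalue floor is `≥ 0` (pure Gram mode in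
particular), the box bound holds at EVERY point feasible for the instance.
[cite: Jansson2007, Thm 4.2 and remark after (4.3), p. 9] [cite: BurerMonteiro2003, §1 eq. (2)] -/
theorem sound' {P : Problem V E I K σ} {R : Radii V E I K σ} {C : LowerCertBox V E I K σ π}
    (h : check P R C = true) (h0 : ∀ k, 0 ≤ (C.wit k).dfloor) {D : RealData V E I K σ}
    (hD : D.InBox P R) {y : V → ℝ} (hy : D.Feasible P y) : (C.lowerBoundBox : ℝ) ≤ D.obj y := by
  refine bound_core h hD hy (fun k => (D.block k y).trace) (fun k => le_rfl) ?_
  have hl : ∑ k, |min 0 ((C.wit k).dfloor : ℝ)| * (D.block k y).trace = 0 :=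
    Finset.sum_eq_zero fun k _ => by
      rw [min_eq_left (show (0 : ℝ) ≤ ((C.wit k).dfloor : ℝ) by exact_mod_cast h0 k), abs_zero,
        zero_mul]
  have hr : LowerCert.penalty P C.toLowerCert = 0 :=
    Finset.sum_eq_zero fun k _ => by rw [min_eq_left (h0 k), abs_zero, zero_mul]
  rw [hl, hr, Rat.cast_zero]

/-- The accepted box bound is below the INFIMUM of the instance's objective over the points feasible for
the instance that satisfy the trace bounds (nonempty such set).
[cite: Jansson2007, Thm 4.2 and remark after (4.3), p. 9] -/
theorem le_csInf {P : Problem V E I K σ} {R : Radii V E I K σ} {C : LowerCertBox V E I K σ π}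
    (h : check P R C = true) {D : RealData V E I K σ} (hD : D.InBox P R)
    (hne : (D.obj '' {y | D.Feasible P y ∧ D.TraceBounds P y}).Nonempty) :
    (C.lowerBoundBox : ℝ) ≤ sInf (D.obj '' {y | D.Feasible P y ∧ D.TraceBounds P y}) :=
  _root_.le_csInf hne (by rintro _ ⟨y, ⟨hy, htr⟩, rfl⟩; exact sound h hD hy htr)

/-- Without penalised blocks: the accepted box bound is below the infimum of the instance's objective
over ALL points feasible for the instance. [cite: Jansson2007, Thm 4.2 and remark after (4.3), p. 9] -/
theorem le_csInf' {P : Problem V E I K σ} {R : Radii V E I K σ} {C : LowerCertBox V E I K σ π}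
    (h : check P R C = true) (h0 : ∀ k, 0 ≤ (C.wit k).dfloor) {D : RealData V E I K σ}
    (hD : D.InBox P R) (hne : (D.obj '' {y | D.Feasible P y}).Nonempty) :
    (C.lowerBoundBox : ℝ) ≤ sInf (D.obj '' {y | D.Feasible P y}) :=
  _root_.le_csInf hne (by rintro _ ⟨y, hy, rfl⟩; exact sound' h h0 hD hy)

/-- **Rational instances**: a second problem DOCUMENT `P′` with the same unit variable, a-priori bounds
and trace bounds whose data lies entrywise within the radii of `P` is an instance of the box, so the
accepted box bound is below `P′`'s objective at every point feasible for `P′` (with `P′`'s trace bounds).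
[cite: Jansson2007, Thm 4.2 and remark after (4.3), p. 9] [cite: JanssonChaykinKeil2008, Thm 3.2
(interval input data)] -/
theorem sound_problem {P P' : Problem V E I K σ} {R : Radii V E I K σ} {C : LowerCertBox V E I K σ π}
    (h : check P R C = true) (hu : P'.unit = P.unit) (hρ : P'.rho = P.rho) (hτ : P'.tau = P.tau)
    (hbox : P'.realData.InBox P R) {y : V → ℝ} (hy : P'.Feasible y) (htr : P'.TraceBounds y) :
    (C.lowerBoundBox : ℝ) ≤ P'.obj y :=
  sound h hbox ((Problem.feasible_realData_iff hu hρ).2 hy) fun k q hq =>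
    htr k q (by rw [hτ]; exact hq)

end LowerCertBox

end ConicLayout

end Literature.Computation.Certificates
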